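import Summits.AtomisticToContinuum.Crystallization.Theorems.FrustratedLawDichotomyStrainedPatchHomLattice

/-!
# The texture-relief half `(R)` read through the lattice sums, and the realisability side conditions of `(H)`
# (27623 strained-patch piece; decomp-a2c, prover hand 2, generation 20 — structural lane of stub 2)

Sequel to `…StrainedPatchHomLattice` (p842566: `HomFloor m ⟺` two lattice-sum inequalities over the realised deformations).

* §1 **(R) as FLOOR + ONE REALISED WITNESS.**  `TextureReliefBound L B` asks, for every admissible cluster, for SOME admissible homogeneous
  instance within `L·σ₁ + B` below it.  Through `ballAvg_xRec_eq_latticeSum_fcc/hcp` the instance's value is its lattice site sum `X(G₀, ξ₀)`, so: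
  (a) `(H) ∧ (R) ⟹` the plain floor `m − (L·σ₁ + B)` on every admissible cluster (`floor_of_homFloor_of_relief`);
  (b) conversely ONE realised deformation `(G₀, ξ₀)` plus the plain floor `X(G₀, ξ₀) − (L·σ₁ + B) ≤ ballAvg` on every admissible cluster
  `⟹ (R)` (`textureReliefBound_of_floor_of_realised_fcc/hcp`) — i.e. what an instrument certifies for (R) is ONE number per reference
  deformation: `S_c(0) ≥ X(G₀, ξ₀) − (L·σ₁ + B)` (numbers of record: `X(HZ00) = 2.075·10⁻³`, `δ★ = 1.15·10⁻³`, measured `S_c(0) = 1.82·10⁻³`);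
  (c) the exact restatement `textureReliefBound_iff_latticeSums`.
* §2 **REALISABILITY SIDE CONDITIONS, fcc.**  For a cluster enumerating a `133/10`-ball of `z c + G·L_fcc` with `‖G − 1‖ ≤ 1/4`, the hard core
  `Sep` and the radius clause of `Admissible` are AUTOMATIC: nonzero fcc lattice vectors have norm `≥ 1` (`one_le_norm_fccPoint`, parity of
  `(a₂+a₃)² + (a₁+a₃)² + (a₁+a₂)²`), hence `‖G v‖ ≥ ¾‖v‖ ≥ 3/4 > 7/10` (`norm_latPt_fcc_ge`, `sep_of_fcc_range`); so
  `Admissible ⟺ Injective ∧ ¬TightNearCap ∧ ¬ExemptNear ∧ ¬BadNearCap` there (`admissible_iff_of_fcc_range`) — the certifier's GoodFit /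
  intruder / ForceOut prunes are exactly the three remaining negative clauses.  (hcp: NOT automatic as typed — a B–A distance can be
  `¾·(1 − ‖ξ‖) ≥ 9/16` only; recorded, not repaired here.)

DEF-FREE; 0 sorry; axioms ⊆ {propext, Classical.choice, Quot.sound}.  `--supports stmt-AtomisticToContinuum-27623`.
-/

noncomputable section

namespace Summit.AtomisticToContinuum.Crystallization.Theorems.FrustratedLawDichotomyStrainedPatchHomRelief

open scoped BigOperators Classical
open Summit.AtomisticToContinuum.Crystallization.Theorems.ChargedEnergyGapNegative (E3)
open Summit.AtomisticToContinuum.Crystallization.Theorems.FrustratedLawDichotomyRangeCut (Sep)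
open Summit.AtomisticToContinuum.Crystallization.Theorems.FrustratedLawDichotomySchurCut (effPot w₄₅ ω₄)
open Summit.AtomisticToContinuum.Crystallization.Theorems.FrustratedLawDichotomyAveragingCut (ball ballAvg mem_ball)
open Summit.AtomisticToContinuum.Crystallization.Theorems.FrustratedLawDichotomyAveragingRuleTightFree (TightNearCap BadNearCap)
open Summit.AtomisticToContinuum.Crystallization.Theorems.FrustratedLawDichotomyExemptAbsorption (ExemptNear)
open Summit.AtomisticToContinuum.Crystallization.Theorems.FrustratedLawDichotomyStrainedPatchHomSplit
open Summit.AtomisticToContinuum.Crystallization.Theorems.FrustratedLawDichotomyStrainedPatchHomLattice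
open Literature.Barriers.AtomisticToContinuum.FlatleyTheil2015 (fccVec fccPoint fccPoint_eq_sum norm_fccPoint_sq)

/-! ## §1. The relief half as a plain floor plus one realised witness -/

/-- ★ **(H) ∧ (R) ⟹ the plain floor `m − (L·σ₁ + B)` on every admissible cluster** (the seam's content, as a floor). [folklore] -/
theorem floor_of_homFloor_of_relief {m L B : ℝ} (hH : HomFloor m) (hR : TextureReliefBound L B) {M : ℕ} {z : Fin M → E3} {c : Fin M}
    (hA : Admissible M z c) : m - (L * sigmaOne + B) ≤ ballAvg (9 / 5) z (xRec M z) c := by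
  obtain ⟨M₀, z₀, c₀, h₀, hhom, hle⟩ := hR M z c hA
  have := hH M₀ z₀ c₀ h₀ hhom
  linarith

/-- ★★ **(R) from a plain floor and ONE realised fcc deformation**: if `G₀` (`‖G₀ − 1‖ ≤ 1/4`) is realised by an admissible fcc ball and every
admissible cluster has `ballAvg ≥ X_fcc(G₀) − (L·σ₁ + B)`, then `TextureReliefBound L B`. [folklore] -/
theorem textureReliefBound_of_floor_of_realised_fcc {L B : ℝ} {G₀ : E3 →L[ℝ] E3} (hG₀ : ‖G₀ - 1‖ ≤ 1 / 4)
    {M₀ : ℕ} {z₀ : Fin M₀ → E3} {c₀ : Fin M₀} (h₀ : Admissible M₀ z₀ c₀)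
    (hrange₀ : Set.range z₀ = {x : E3 | dist x (z₀ c₀) ≤ 133 / 10 ∧ ∃ a : Fin 3 → ℤ, x = z₀ c₀ + latPt G₀ fccVec a})
    (hfloor : ∀ (M : ℕ) (z : Fin M → E3) (c : Fin M), Admissible M z c →
      (∑ᶠ v ∈ {v : E3 | v ≠ 0 ∧ ∃ b : Fin 3 → ℤ, v = latPt G₀ fccVec b}, effPot w₄₅ ω₄ (3 / 400) ‖v‖) / 2 - (-(7175 / 10000) + 3 / 400)
        - (L * sigmaOne + B) ≤ ballAvg (9 / 5) z (xRec M z) c) :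
    TextureReliefBound L B := fun M z c hA =>
  ⟨M₀, z₀, c₀, h₀, ⟨G₀, 0, hG₀, by simp, Or.inl hrange₀⟩, by
    rw [ballAvg_xRec_eq_latticeSum_fcc h₀ hrange₀]; exact hfloor M z c hA⟩

/-- ★★ **(R) from a plain floor and ONE realised hcp deformation** (`‖G₀ − 1‖ ≤ 1/4`, `‖ξ₀‖ ≤ 1/4`; the reference of record is of this kind:
family A = strained hcp with relaxed shuffle). [folklore] -/
theorem textureReliefBound_of_floor_of_realised_hcp {L B : ℝ} {G₀ : E3 →L[ℝ] E3} {ξ₀ : E3} (hG₀ : ‖G₀ - 1‖ ≤ 1 / 4) (hξ₀ : ‖ξ₀‖ ≤ 1 / 4)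
    {M₀ : ℕ} {z₀ : Fin M₀ → E3} {c₀ : Fin M₀} (h₀ : Admissible M₀ z₀ c₀)
    (hrange₀ : Set.range z₀ = {x : E3 | dist x (z₀ c₀) ≤ 133 / 10 ∧ ∃ a : Fin 3 → ℤ,
      x = z₀ c₀ + latPt G₀ hexFrame a ∨ x = z₀ c₀ + latPt G₀ hexFrame a + G₀ (hcpShift + ξ₀)})
    (hfloor : ∀ (M : ℕ) (z : Fin M → E3) (c : Fin M), Admissible M z c →
      (∑ᶠ v ∈ {v : E3 | v ≠ 0 ∧ ∃ b : Fin 3 → ℤ, v = latPt G₀ hexFrame b ∨ v = latPt G₀ hexFrame b + G₀ (hcpShift + ξ₀)},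
          effPot w₄₅ ω₄ (3 / 400) ‖v‖) / 2 - (-(7175 / 10000) + 3 / 400) - (L * sigmaOne + B) ≤ ballAvg (9 / 5) z (xRec M z) c) :
    TextureReliefBound L B := fun M z c hA =>
  ⟨M₀, z₀, c₀, h₀, ⟨G₀, ξ₀, hG₀, hξ₀, Or.inr hrange₀⟩, by
    rw [ballAvg_xRec_eq_latticeSum_hcp h₀ hrange₀]; exact hfloor M z c hA⟩

/-- ★ **(R) IS «for every admissible cluster, some REALISED deformation's lattice sum minus the allowance lies below its ball average»**
(exact restatement through `…HomLattice`). [folklore] -/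
theorem textureReliefBound_iff_latticeSums {L B : ℝ} :
    TextureReliefBound L B ↔ ∀ (M : ℕ) (z : Fin M → E3) (c : Fin M), Admissible M z c →
      (∃ (G₀ : E3 →L[ℝ] E3) (M₀ : ℕ) (z₀ : Fin M₀ → E3) (c₀ : Fin M₀), ‖G₀ - 1‖ ≤ 1 / 4 ∧ Admissible M₀ z₀ c₀ ∧
          Set.range z₀ = {x : E3 | dist x (z₀ c₀) ≤ 133 / 10 ∧ ∃ a : Fin 3 → ℤ, x = z₀ c₀ + latPt G₀ fccVec a} ∧
          (∑ᶠ v ∈ {v : E3 | v ≠ 0 ∧ ∃ b : Fin 3 → ℤ, v = latPt G₀ fccVec b}, effPot w₄₅ ω₄ (3 / 400) ‖v‖) / 2 - (-(7175 / 10000) + 3 / 400)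
            - (L * sigmaOne + B) ≤ ballAvg (9 / 5) z (xRec M z) c) ∨
      (∃ (G₀ : E3 →L[ℝ] E3) (ξ₀ : E3) (M₀ : ℕ) (z₀ : Fin M₀ → E3) (c₀ : Fin M₀), ‖G₀ - 1‖ ≤ 1 / 4 ∧ ‖ξ₀‖ ≤ 1 / 4 ∧ Admissible M₀ z₀ c₀ ∧
          Set.range z₀ = {x : E3 | dist x (z₀ c₀) ≤ 133 / 10 ∧ ∃ a : Fin 3 → ℤ,
            x = z₀ c₀ + latPt G₀ hexFrame a ∨ x = z₀ c₀ + latPt G₀ hexFrame a + G₀ (hcpShift + ξ₀)} ∧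
          (∑ᶠ v ∈ {v : E3 | v ≠ 0 ∧ ∃ b : Fin 3 → ℤ, v = latPt G₀ hexFrame b ∨ v = latPt G₀ hexFrame b + G₀ (hcpShift + ξ₀)},
              effPot w₄₅ ω₄ (3 / 400) ‖v‖) / 2 - (-(7175 / 10000) + 3 / 400) - (L * sigmaOne + B) ≤ ballAvg (9 / 5) z (xRec M z) c) := by
  constructor
  · intro h M z c hA
    obtain ⟨M₀, z₀, c₀, h₀, ⟨G₀, ξ₀, hG₀, hξ₀, hr | hr⟩, hle⟩ := h M z c hA
    · exact Or.inl ⟨G₀, M₀, z₀, c₀, hG₀, h₀, hr, by rwa [ballAvg_xRec_eq_latticeSum_fcc h₀ hr] at hle⟩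
    · exact Or.inr ⟨G₀, ξ₀, M₀, z₀, c₀, hG₀, hξ₀, h₀, hr, by rwa [ballAvg_xRec_eq_latticeSum_hcp h₀ hr] at hle⟩
  · intro h M z c hA
    rcases h M z c hA with ⟨G₀, M₀, z₀, c₀, hG₀, h₀, hr, hle⟩ | ⟨G₀, ξ₀, M₀, z₀, c₀, hG₀, hξ₀, h₀, hr, hle⟩
    · exact ⟨M₀, z₀, c₀, h₀, ⟨G₀, 0, hG₀, by simp, Or.inl hr⟩, by rwa [ballAvg_xRec_eq_latticeSum_fcc h₀ hr]⟩
    · exact ⟨M₀, z₀, c₀, h₀, ⟨G₀, ξ₀, hG₀, hξ₀, Or.inr hr⟩, by rwa [ballAvg_xRec_eq_latticeSum_hcp h₀ hr]⟩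

/-! ## §2. Realisability side conditions are automatic for fcc balls -/

/-- ★ **Nonzero fcc lattice vectors have norm at least `1`** (the nearest-neighbour distance): `‖fccPoint a‖² = ((a₂+a₃)² + (a₁+a₃)² + (a₁+a₂)²)/2`
and the integer numerator is even and nonzero, hence `≥ 2`. [folklore] -/
theorem one_le_norm_fccPoint {a : Fin 3 → ℤ} (ha : a ≠ 0) : 1 ≤ ‖fccPoint a‖ := by
  have hsum : 1 ≤ a 0 ^ 2 + a 1 ^ 2 + a 2 ^ 2 := by
    by_contra hlt
    have hle : a 0 ^ 2 + a 1 ^ 2 + a 2 ^ 2 ≤ 0 := by linarith [Int.lt_iff_add_one_le.mp (not_le.mp hlt)]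
    have h0 : a 0 ^ 2 = 0 := le_antisymm (by nlinarith [sq_nonneg (a 1), sq_nonneg (a 2)]) (sq_nonneg _)
    have h1 : a 1 ^ 2 = 0 := le_antisymm (by nlinarith [sq_nonneg (a 0), sq_nonneg (a 2)]) (sq_nonneg _)
    have h2 : a 2 ^ 2 = 0 := le_antisymm (by nlinarith [sq_nonneg (a 0), sq_nonneg (a 1)]) (sq_nonneg _)
    have e0 : a 0 = 0 := (pow_eq_zero_iff two_ne_zero).1 h0
    have e1 : a 1 = 0 := (pow_eq_zero_iff two_ne_zero).1 h1
    have e2 : a 2 = 0 := (pow_eq_zero_iff two_ne_zero).1 h2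
    exact ha (funext fun i => by fin_cases i <;> simp [e0, e1, e2])
  have hQ2 : 1 ≤ 2 * ((a 0) ^ 2 + (a 1) ^ 2 + (a 2) ^ 2 + a 0 * a 1 + a 0 * a 2 + a 1 * a 2) := by
    nlinarith [sq_nonneg (a 0 + a 1 + a 2), hsum]
  have hQ : 1 ≤ (a 0) ^ 2 + (a 1) ^ 2 + (a 2) ^ 2 + a 0 * a 1 + a 0 * a 2 + a 1 * a 2 := by omega
  have hS : (2 : ℤ) ≤ (a 1 + a 2) ^ 2 + (a 0 + a 2) ^ 2 + (a 0 + a 1) ^ 2 := by nlinarith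
  have hS' : (2 : ℝ) ≤ (((a 1 + a 2) ^ 2 + (a 0 + a 2) ^ 2 + (a 0 + a 1) ^ 2 : ℤ) : ℝ) := by exact_mod_cast hS
  have h1 : 1 ≤ ‖fccPoint a‖ ^ 2 := by rw [norm_fccPoint_sq]; linarith
  exact (one_le_sq_iff₀ (norm_nonneg _)).1 h1

/-- `latPt G fccVec a = G (fccPoint a)`. [formal bookkeeping] -/
theorem latPt_fccVec_eq (G : E3 →L[ℝ] E3) (a : Fin 3 → ℤ) : latPt G fccVec a = G (fccPoint a) := by
  unfold latPt
  rw [fccPoint_eq_sum]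

/-- ★ **`‖G − 1‖ ≤ 1/4` ⟹ nonzero deformed fcc lattice vectors have norm `≥ 3/4`**: `‖G v‖ ≥ ‖v‖ − ‖(G − 1) v‖ ≥ ¾‖v‖`. [folklore] -/
theorem norm_latPt_fcc_ge {G : E3 →L[ℝ] E3} (hG : ‖G - 1‖ ≤ 1 / 4) {a : Fin 3 → ℤ} (ha : a ≠ 0) : 3 / 4 ≤ ‖latPt G fccVec a‖ := by
  rw [latPt_fccVec_eq]
  set w : E3 := fccPoint a with hw
  have h1 : 1 ≤ ‖w‖ := one_le_norm_fccPoint ha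
  have hdec : w = G w - (G - 1) w := by simp
  have htri : ‖w‖ ≤ ‖G w‖ + ‖(G - 1) w‖ := by
    calc ‖w‖ = ‖G w - (G - 1) w‖ := by rw [← hdec]
      _ ≤ ‖G w‖ + ‖(G - 1) w‖ := norm_sub_le _ _
  have hop : ‖(G - 1) w‖ ≤ 1 / 4 * ‖w‖ := ((G - 1).le_opNorm w).trans (mul_le_mul_of_nonneg_right hG (norm_nonneg _))
  linarith

/-- ★ **The hard core is automatic on deformed fcc balls**: an injective cluster whose points lie on `z c + G·L_fcc`, `‖G − 1‖ ≤ 1/4`, is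
`7/10`-separated (indeed `3/4`-separated). [folklore] -/
theorem sep_of_fcc_range {M : ℕ} {z : Fin M → E3} {c : Fin M} {G : E3 →L[ℝ] E3} (hG : ‖G - 1‖ ≤ 1 / 4) (hz : Function.Injective z)
    (hrange : ∀ k : Fin M, ∃ a : Fin 3 → ℤ, z k = z c + latPt G fccVec a) : Sep z := by
  intro k k' hne
  obtain ⟨a, ha⟩ := hrange k
  obtain ⟨a', ha'⟩ := hrange k'
  have hdiff : z k - z k' = latPt G fccVec (a - a') := by rw [latPt_sub, ha, ha']; abel
  have hne' : a - a' ≠ 0 := by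
    intro h
    have : z k = z k' := by
      have := hdiff; rw [h] at this; simp [latPt] at this; exact sub_eq_zero.1 this
    exact hne (hz this)
  rw [dist_eq_norm, hdiff]
  linarith [norm_latPt_fcc_ge hG hne']

/-- ★★ **`Admissible` on a deformed fcc ball = injectivity + the three negative clauses** (`Sep` and the radius clause are automatic):
what the certifier's prunes (a `1/20`-good member / a `1/8`-bad member / a T-exempt reach site) negate is exactly the rest. [folklore] -/
theorem admissible_iff_of_fcc_range {M : ℕ} {z : Fin M → E3} {c : Fin M} {G : E3 →L[ℝ] E3} (hG : ‖G - 1‖ ≤ 1 / 4)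
    (hrange : Set.range z = {x : E3 | dist x (z c) ≤ 133 / 10 ∧ ∃ a : Fin 3 → ℤ, x = z c + latPt G fccVec a}) :
    Admissible M z c ↔ Function.Injective z ∧ ¬TightNearCap (9 / 5) (3 / 2) z c ∧ ¬ExemptNear (9 / 5) ExRec z c ∧
      ¬BadNearCap (9 / 5) (3 / 2) z c := by
  have hmem : ∀ k : Fin M, dist (z k) (z c) ≤ 133 / 10 ∧ ∃ a : Fin 3 → ℤ, z k = z c + latPt G fccVec a := fun k => by
    have hk : z k ∈ Set.range z := ⟨k, rfl⟩
    rw [hrange] at hk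
    exact hk
  constructor
  · rintro ⟨hz, -, -, hT, hE, hB⟩
    exact ⟨hz, hT, hE, hB⟩
  · rintro ⟨hz, hT, hE, hB⟩
    exact ⟨hz, sep_of_fcc_range hG hz fun k => (hmem k).2, fun k => (hmem k).1, hT, hE, hB⟩

end Summit.AtomisticToContinuum.Crystallization.Theorems.FrustratedLawDichotomyStrainedPatchHomRelief

end
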